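import Mathlib
import Literature.Analysis.FluidPDE.BeltramiFlows
import Summits.NavierStokesRegularity.NavierStokesRegularity.Theorems.QuarterLogPincerSmoothSilenceDefs
import Summits.NavierStokesRegularity.NavierStokesRegularity.Theorems.TypeIQuantSubcubicExp.Negative.SilencingCostBurnout
import Summits.NavierStokesRegularity.NavierStokesRegularity.Theorems.DssFarFieldSlavingBlowupTypeIDssProfileGaussianGapIdentities
import HarnessLib

/-!
# Sc″ `DriftStretchSilencingCost`: the silencing constant is STRETCHED-EXPONENTIALLY SMALL in `B²/δ` (tightness) — refuter lane ns-afl-r1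

Supports crux stmt-NavierStokesRegularity-24077 (`QuarterLogPincer.TypeIQuantSubcubicExp`) via ns-idea-7's line
`smooth_silence` v1.2 (Sc″ = `SmoothSilence.DriftStretchSilencingCost`, `SmoothSilence.DriftStretchBox`, in the tree
BY NAME: `…Theorems.QuarterLogPincerSmoothSilenceDefs`, pub-ns-dss typer g38).  NO Theses decl is asserted and Sc″ is
neither proved nor refuted (HONEST FRAME: 24077, W7 and Navier–Stokes regularity are OPEN).  TIGHTNESS LEMMA for
provers, companion of `…Negative.SilencingCostExpSmall` (Sc′).

* `norm_iteratedFDeriv_abc_shear_le` (theorem-only file, no definitions) — all derivatives of the polarised shear wave `abc 0 1 0 = (0, sin x₀, cos x₀)`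
  have norm `≤ 1` (it is `g ∘ proj₀` with `g(u) = sin u·e₁ + cos u·e₂`, `‖g⁽ⁿ⁾‖ ≡ 1`, and `‖proj₀‖ ≤ 1` =
  the tree's `GaussianGap.norm_proj_le_one`).
* `driftStretch_silencingConstant_le` — if `(K, c)` satisfies Sc″'s universal clause (VERBATIM) at
  `(B, γ, δ, Γ₂)` with `δ ≤ B²`, then `c ≤ 5·δ·K³·exp(−2(B²/δ)^{1/5})`.  Witness: the drift-free (`v ≡ 0`)
  exact caloric Beltrami mode `ω = A e^{−s}·abc 0 1 0` at the scale `σ` with `σ¹⁰ = B²/δ`, `A = Bσ⁻⁷`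
  (so `‖∇ʲω‖ ≤ A ≤ Bσ^{-(j+2)}` for all `j ≤ 5`; `∂ₛω = Δω` is the drift–stretch equation with `v = 0`):
  centre enstrophy `(4π/3)Γ₂³·δ/σ ≥ δ/σ`, and after the admissible span `σ²` the enstrophy on `B(0,Kσ)` is
  `(4π/3)δK³e^{−2σ²}/σ` with `σ² = (B²/δ)^{1/5}`.  The fifth-order derivative cap of the class is what turns
  Sc′'s `e^{−2B²/δ}` into `e^{−2(B²/δ)^{1/5}}`: frequency `(B²/δ)^{1/10}` in box units is the fastest
  admissible burn-out.  ANY proof of Sc″ (equivalently of L♯2, cf. `…Negative.SmoothSilenceFailingFamilyIff`)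
  must produce `c ≤ 5δK³exp(−2(B²/δ)^{1/5})`.
* `driftStretchSilencingCost_constant_le` — by-name link to `SmoothSilence.DriftStretchSilencingCost`.
-/

-- the summit and its single sub-problem share the name (CONVENTIONS §1), as in every Theorems file
set_option linter.dupNamespace false

namespace Summit.NavierStokesRegularity.NavierStokesRegularity.Theorems.TypeIQuantSubcubicExp.Negative.SmoothSilence

noncomputable section

open MeasureTheory Set Function Filter Topology Metric Real
open scoped ENNReal NNReal Laplacian
open Literature.Analysis Literature.Analysis.FluidPDE
open Summit.NavierStokesRegularity.NavierStokesRegularity.Theorems.TypeIQuantSubcubicExp.Negative.SilencingCost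
  (norm_abc_shear lintegral_ball_of_norm_const)
open Summit.NavierStokesRegularity.NavierStokesRegularity.Cruxes.TypeIQuantSubcubicExp.SmoothSilence
  (DriftStretchBox DriftStretchSilencingCost)

/-! ## All derivatives of the polarised shear wave have norm ≤ 1 -/

/-! The polarised circle `g_c(u) = sin(u+c)·e₁ + cos(u+c)·e₂` in `ℝ³` (phase `c`) is written out in full below
(no definition is introduced, so that this file stays on the proof lane). -/

/-- `‖g_c(u)‖ = 1`. -/
theorem norm_pol (c u : ℝ) : ‖(fun u : ℝ => Real.sin (u + c) • EuclideanSpace.single (1 : Fin 3) (1 : ℝ) + Real.cos (u + c) • EuclideanSpace.single (2 : Fin 3) (1 : ℝ)) u‖ = 1 := by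
  rw [EuclideanSpace.norm_eq, Fin.sum_univ_three]
  simp [Real.sin_sq_add_cos_sq]

/-- `g_c' = g_{c+π/2}` (differentiation is a quarter turn of the phase). -/
theorem hasDerivAt_pol (c u : ℝ) :
    HasDerivAt (fun u : ℝ => Real.sin (u + c) • EuclideanSpace.single (1 : Fin 3) (1 : ℝ) + Real.cos (u + c) • EuclideanSpace.single (2 : Fin 3) (1 : ℝ))
      ((fun u : ℝ => Real.sin (u + (c + π / 2)) • EuclideanSpace.single (1 : Fin 3) (1 : ℝ) + Real.cos (u + (c + π / 2)) • EuclideanSpace.single (2 : Fin 3) (1 : ℝ)) u) u := by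
  have h1 : HasDerivAt (fun u => Real.sin (u + c)) (Real.cos (u + c)) u := by
    simpa using ((hasDerivAt_id u).add_const c).sin
  have h2 : HasDerivAt (fun u => Real.cos (u + c)) (-Real.sin (u + c)) u := by
    simpa using ((hasDerivAt_id u).add_const c).cos
  have h := (h1.smul_const (EuclideanSpace.single (1 : Fin 3) (1 : ℝ))).add (h2.smul_const (EuclideanSpace.single (2 : Fin 3) (1 : ℝ)))
  have hval : (fun u : ℝ => Real.sin (u + (c + π / 2)) • EuclideanSpace.single (1 : Fin 3) (1 : ℝ) + Real.cos (u + (c + π / 2)) • EuclideanSpace.single (2 : Fin 3) (1 : ℝ)) u =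
      Real.cos (u + c) • EuclideanSpace.single (1 : Fin 3) (1 : ℝ) + (-Real.sin (u + c)) • EuclideanSpace.single (2 : Fin 3) (1 : ℝ) := by
    simp only
    rw [show u + (c + π / 2) = (u + c) + π / 2 by ring, Real.sin_add_pi_div_two, Real.cos_add_pi_div_two]
  rw [hval]
  exact h

/-- `deriv g_c = g_{c+π/2}`. -/
theorem deriv_pol (c : ℝ) :
    deriv (fun u : ℝ => Real.sin (u + c) • EuclideanSpace.single (1 : Fin 3) (1 : ℝ) + Real.cos (u + c) • EuclideanSpace.single (2 : Fin 3) (1 : ℝ)) = (fun u : ℝ => Real.sin (u + (c + π / 2)) • EuclideanSpace.single (1 : Fin 3) (1 : ℝ) + Real.cos (u + (c + π / 2)) • EuclideanSpace.single (2 : Fin 3) (1 : ℝ)) := by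
  funext u; exact (hasDerivAt_pol c u).deriv

/-- `g_c⁽ⁿ⁾ = g_{c+nπ/2}`. -/
theorem iteratedDeriv_pol (n : ℕ) (c : ℝ) :
    iteratedDeriv n (fun u : ℝ => Real.sin (u + c) • EuclideanSpace.single (1 : Fin 3) (1 : ℝ) + Real.cos (u + c) • EuclideanSpace.single (2 : Fin 3) (1 : ℝ)) = (fun u : ℝ => Real.sin (u + (c + n * (π / 2))) • EuclideanSpace.single (1 : Fin 3) (1 : ℝ) + Real.cos (u + (c + n * (π / 2))) • EuclideanSpace.single (2 : Fin 3) (1 : ℝ)) := by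
  induction n generalizing c with
  | zero => simp
  | succ n ih =>
    rw [iteratedDeriv_succ', deriv_pol, ih]
    funext u
    simp only [Nat.cast_succ]
    rw [show u + (c + π / 2 + n * (π / 2)) = u + (c + (n + 1) * (π / 2)) by ring]

/-- `g_c` is smooth. -/
theorem contDiff_pol (c : ℝ) {n : WithTop ℕ∞} : ContDiff ℝ n (fun u : ℝ => Real.sin (u + c) • EuclideanSpace.single (1 : Fin 3) (1 : ℝ) + Real.cos (u + c) • EuclideanSpace.single (2 : Fin 3) (1 : ℝ)) := by
  fun_prop

/-- `‖g_c⁽ⁿ⁾(u)‖ = 1` (as an `n`-multilinear map on `ℝ`). -/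
theorem norm_iteratedFDeriv_pol (n : ℕ) (c u : ℝ) : ‖iteratedFDeriv ℝ n (fun u : ℝ => Real.sin (u + c) • EuclideanSpace.single (1 : Fin 3) (1 : ℝ) + Real.cos (u + c) • EuclideanSpace.single (2 : Fin 3) (1 : ℝ)) u‖ = 1 := by
  rw [norm_iteratedFDeriv_eq_norm_iteratedDeriv, iteratedDeriv_pol, norm_pol]

/-- `abc 0 1 0 = g₀ ∘ proj₀`. -/
theorem abc_shear_eq_pol_comp :
    ABC.abc 0 1 0 = (fun u : ℝ => Real.sin (u + 0) • EuclideanSpace.single (1 : Fin 3) (1 : ℝ) + Real.cos (u + 0) • EuclideanSpace.single (2 : Fin 3) (1 : ℝ)) ∘ (EuclideanSpace.proj (0 : Fin 3) : EuclideanSpace ℝ (Fin 3) →L[ℝ] ℝ) := by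
  funext x
  ext j
  fin_cases j <;> simp

/-- **All derivatives of the polarised shear wave have norm `≤ 1`.** -/
theorem norm_iteratedFDeriv_abc_shear_le (n : ℕ) (x : EuclideanSpace ℝ (Fin 3)) :
    ‖iteratedFDeriv ℝ n (ABC.abc 0 1 0) x‖ ≤ 1 := by
  rw [abc_shear_eq_pol_comp, ContinuousLinearMap.iteratedFDeriv_comp_right _ (contDiff_pol 0) x
    (by exact_mod_cast le_top)]
  refine (ContinuousMultilinearMap.norm_compContinuousLinearMap_le _ _).trans ?_
  rw [norm_iteratedFDeriv_pol, one_mul]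
  exact Finset.prod_le_one (fun _ _ => norm_nonneg _) (fun _ _ => GaussianGap.norm_proj_le_one 0)

/-! ## The tightness witness for Sc″ -/

/-- **Sc″'s universal clause at `(B, γ, K, δ, Γ₂, c)`** forces `c ≤ 5δK³exp(−2(B²/δ)^{1/5})` whenever `δ ≤ B²`
(the clause is VERBATIM the matrix of `SmoothSilence.DriftStretchSilencingCost`; no definition of the line is
modified). -/
theorem driftStretch_silencingConstant_le {B γ δ Γ₂ K c : ℝ} (hB : 1 ≤ B) (hδ : 0 < δ) (hδB : δ ≤ B ^ 2)
    (hΓ₂ : 1 ≤ Γ₂) (hK : Γ₂ ≤ K)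
    (H : ∀ (ω v : ℝ → (EuclideanSpace ℝ (Fin 3)) → (EuclideanSpace ℝ (Fin 3))) (y : (EuclideanSpace ℝ (Fin 3)))
      (σ t t₁ : ℝ), 0 < σ → t < t₁ → t₁ ≤ t + σ ^ 2 →
      DriftStretchBox B γ σ ω v y (Icc t t₁) (2 * K * σ) →
      ENNReal.ofReal (δ / σ) ≤ ∫⁻ x in ball y (Γ₂ * σ), ‖ω t x‖ₑ ^ 2 →
      ENNReal.ofReal (c / σ) ≤ ∫⁻ x in ball y (K * σ), ‖ω t₁ x‖ₑ ^ 2) :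
    c ≤ 5 * δ * K ^ 3 * Real.exp (-(2 * (B ^ 2 / δ) ^ (1 / 5 : ℝ))) := by
  have hB0 : 0 < B := by linarith
  have hK0 : 0 < K := by linarith
  -- the scale: `σ² = S := (B²/δ)^{1/5} ≥ 1`, `σ¹⁰ = B²/δ`
  have hR1 : 1 ≤ B ^ 2 / δ := by rw [le_div_iff₀ hδ]; linarith
  have hR0 : 0 ≤ B ^ 2 / δ := by positivity
  set S : ℝ := (B ^ 2 / δ) ^ (1 / 5 : ℝ) with hS_def
  have hS1 : 1 ≤ S := Real.one_le_rpow hR1 (by norm_num)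
  have hS0 : 0 < S := by linarith
  have hS5 : S ^ 5 = B ^ 2 / δ := by
    rw [hS_def, ← Real.rpow_natCast, ← Real.rpow_mul hR0]; norm_num
  set σ : ℝ := Real.sqrt S with hσ_def
  have hσ1 : 1 ≤ σ := Real.one_le_sqrt.2 hS1
  have hσ0 : 0 < σ := by linarith
  have hσsq : σ ^ 2 = S := Real.sq_sqrt hS0.le
  have hσ10 : σ ^ 10 = B ^ 2 / δ := by
    rw [show σ ^ 10 = (σ ^ 2) ^ 5 by ring, hσsq, hS5]
  have hq7 : σ ^ (-(7 : ℝ)) = (σ ^ 7)⁻¹ := by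
    rw [Real.rpow_neg hσ0.le, show (7 : ℝ) = ((7 : ℕ) : ℝ) by norm_num, Real.rpow_natCast]
  -- the amplitude `A = Bσ⁻⁷`, with `A²σ⁴ = δ`
  set A : ℝ := B * σ ^ (-(7 : ℝ)) with hA_def
  have hA0 : 0 < A := mul_pos hB0 (Real.rpow_pos_of_pos hσ0 _)
  have hAσ : A ^ 2 * σ ^ 4 = δ := by
    rw [hA_def, hq7]
    have hσ7 : σ ^ 7 ≠ 0 := by positivity
    have hδ0 : δ ≠ 0 := hδ.ne'
    field_simp
    have : B ^ 2 = δ * σ ^ 10 := by rw [hσ10]; field_simp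
    nlinarith [this]
  -- the witness pair `(ω, v) = (A e^{-s}·abc 0 1 0, 0)`
  set a : EuclideanSpace ℝ (Fin 3) → EuclideanSpace ℝ (Fin 3) := ABC.abc 0 1 0 with ha_def
  set ω : ℝ → EuclideanSpace ℝ (Fin 3) → EuclideanSpace ℝ (Fin 3) :=
    fun s x => (A * Real.exp (-s)) • a x with hω_def
  set v : ℝ → EuclideanSpace ℝ (Fin 3) → EuclideanSpace ℝ (Fin 3) := fun _ _ => 0 with hv_def
  have hnorm : ∀ s x, ‖ω s x‖ = A * Real.exp (-s) := by
    intro s x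
    rw [hω_def]
    dsimp only
    rw [norm_smul, ha_def, norm_abc_shear, mul_one, Real.norm_eq_abs,
      abs_of_pos (mul_pos hA0 (Real.exp_pos _))]
  have hσ2pos : (0 : ℝ) < σ ^ 2 := by positivity
  have hbox : DriftStretchBox B γ σ ω v 0 (Icc 0 (σ ^ 2)) (2 * K * σ) := by
    unfold DriftStretchBox
    refine ⟨?_, ?_, fun s hs x _ => ⟨?_, ?_, ?_, ?_⟩⟩
    · -- joint smoothness of `ω` on `[0,σ²] × ℝ³`
      change ContDiffOn ℝ _ (uncurry ω) _
      refine ContDiff.contDiffOn ?_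
      have h1 : ContDiff ℝ ((⊤ : ℕ∞) : WithTop ℕ∞) fun p : ℝ × EuclideanSpace ℝ (Fin 3) =>
          A * Real.exp (-p.1) :=
        contDiff_const.mul (Real.contDiff_exp.comp contDiff_fst.neg)
      have h2 : ContDiff ℝ ((⊤ : ℕ∞) : WithTop ℕ∞) fun p : ℝ × EuclideanSpace ℝ (Fin 3) => a p.2 :=
        (ABC.contDiff_abc 0 1 0).comp contDiff_snd
      exact h1.smul h2
    · -- joint smoothness of `v = 0`
      change ContDiffOn ℝ _ (uncurry v) _
      exact contDiff_const.contDiffOn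
    · -- `‖∇ʲω‖ ≤ A e^{-s} ≤ A = Bσ⁻⁷ ≤ Bσ^{-(j+2)}` for `j ≤ 5`
      intro j hj
      have hes : Real.exp (-s) ≤ 1 := Real.exp_le_one_iff.2 (by linarith [hs.1])
      have hAe : 0 < A * Real.exp (-s) := mul_pos hA0 (Real.exp_pos _)
      have e1 : ω s = (A * Real.exp (-s)) • a := by funext z; rfl
      rw [e1, iteratedFDeriv_const_smul_apply ((ABC.contDiff_abc 0 1 0).contDiffAt), norm_smul,
        Real.norm_eq_abs, abs_of_pos hAe]
      have hj' : (j : ℝ) + 2 ≤ 7 := by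
        have : (j : ℝ) ≤ 5 := by exact_mod_cast hj
        linarith
      calc A * Real.exp (-s) * ‖iteratedFDeriv ℝ j a x‖ ≤ A * Real.exp (-s) * 1 :=
            mul_le_mul_of_nonneg_left (by rw [ha_def]; exact norm_iteratedFDeriv_abc_shear_le j x) hAe.le
        _ ≤ A := by nlinarith
        _ = B * σ ^ (-(7 : ℝ)) := rfl
        _ ≤ B * σ ^ (-((j : ℝ) + 2)) :=
            mul_le_mul_of_nonneg_left (Real.rpow_le_rpow_of_exponent_le hσ1 (by linarith)) hB0.le
    · -- `v = 0`: all derivative bounds are `0 ≤ …`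
      intro j _
      have : iteratedFDeriv ℝ j (v s) x = 0 := by
        rw [show v s = fun _ => (0 : EuclideanSpace ℝ (Fin 3)) from rfl, iteratedFDeriv_fun_zero]
        rfl
      rw [this, norm_zero]
      positivity
    · -- `v = 0`: the three Hölder moduli are `0 ≤ …`
      intro s' _
      simp only [hv_def, sub_self, norm_zero]
      refine ⟨by positivity, by positivity, by positivity⟩
    · -- the drift–stretch equation with `v = 0`: `∂ₛω = Δω`
      have hderiv : timeDerivWithin (Icc 0 (σ ^ 2)) ω s x = (A * (Real.exp (-s) * -1)) • a x := by
        have hd : HasDerivAt (fun s' : ℝ => ω s' x) ((A * (Real.exp (-s) * -1)) • a x) s := by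
          have := ((hasDerivAt_neg s).exp.const_mul A).smul_const (a x)
          simpa [hω_def] using this
        rw [timeDerivWithin]
        exact hd.hasDerivWithinAt.derivWithin (uniqueDiffOn_Icc hσ2pos s hs)
      have hlap : (Δ (ω s)) x = (A * Real.exp (-s)) • (-a x) := by
        have e1 : ω s = (A * Real.exp (-s)) • a := by
          funext z; rfl
        rw [e1, InnerProductSpace.laplacian_smul _ ((ABC.contDiff_abc 0 1 0).contDiffAt (n := 2)), ha_def,
          ABC.laplacian_abc]
      have hv1 : fderiv ℝ (v s) x = 0 := by
        rw [show v s = fun _ => (0 : EuclideanSpace ℝ (Fin 3)) from rfl]; exact fderiv_const_apply 0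
      have hv2 : v s x = 0 := rfl
      have hc : A * (Real.exp (-s) * -1) = -(A * Real.exp (-s)) := by ring
      rw [hv1, hv2, map_zero, hderiv, hlap, hc, neg_smul, smul_neg]
      simp
  have key := H ω v 0 σ 0 (σ ^ 2) hσ0 hσ2pos (by simp) hbox ?_
  · -- read the conclusion: `c/σ ≤ (A e^{-σ²})²·(4π/3)(Kσ)³`
    rw [lintegral_ball_of_norm_const (ω (σ ^ 2)) _ (mul_pos hA0 (Real.exp_pos _)).le (hnorm _) 0 (K * σ)
      (by positivity), ENNReal.ofReal_le_ofReal_iff (by positivity), div_le_iff₀ hσ0] at key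
    have hexp : Real.exp (-σ ^ 2) ^ 2 = Real.exp (-(2 * (B ^ 2 / δ) ^ (1 / 5 : ℝ))) := by
      rw [← Real.exp_nat_mul]; congr 1; rw [hσsq, hS_def]; push_cast; ring
    have hE0 : 0 < Real.exp (-(2 * (B ^ 2 / δ) ^ (1 / 5 : ℝ))) := Real.exp_pos _
    set E := Real.exp (-(2 * (B ^ 2 / δ) ^ (1 / 5 : ℝ))) with hE_def
    rw [mul_pow, hexp] at key
    -- key : c ≤ A² E ((Kσ)³(4π/3)) σ = (4π/3) (A²σ⁴) K³ E = (4π/3) δ K³ E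
    have h1 : A ^ 2 * E * ((K * σ) ^ 3 * (π * 4 / 3)) * σ = (π * 4 / 3) * (A ^ 2 * σ ^ 4) * K ^ 3 * E := by
      ring
    rw [h1, hAσ] at key
    have hπ : π < 3.15 := Real.pi_lt_d2
    have h2 : (π * 4 / 3) * δ * K ^ 3 * E ≤ 5 * δ * K ^ 3 * E := by
      have hpos : 0 ≤ δ * K ^ 3 * E := by positivity
      nlinarith
    exact key.trans h2
  · -- the initial centre enstrophy on `B(0,Γ₂σ)`: `A²·(4π/3)(Γ₂σ)³ = (4π/3)Γ₂³·δ/σ ≥ δ/σ`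
    rw [lintegral_ball_of_norm_const (ω 0) A hA0.le
      (fun x => by rw [hnorm, neg_zero, Real.exp_zero, mul_one]) 0 (Γ₂ * σ) (by positivity)]
    refine ENNReal.ofReal_le_ofReal ?_
    have hπ : 3 < π := Real.pi_gt_three
    have hΓ3 : 1 ≤ Γ₂ ^ 3 := one_le_pow₀ hΓ₂
    have e : A ^ 2 * ((Γ₂ * σ) ^ 3 * (π * 4 / 3)) = (π * 4 / 3 * Γ₂ ^ 3) * ((A ^ 2 * σ ^ 4) / σ) := by
      field_simp
    rw [e, hAσ]
    have hone : 1 ≤ π * 4 / 3 * Γ₂ ^ 3 := by nlinarith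
    exact le_mul_of_one_le_left (by positivity) hone

/-- **By-name link** (logically weak — it CERTIFIES that the clause of `driftStretch_silencingConstant_le` is the
matrix of Sc″ `SmoothSilence.DriftStretchSilencingCost` verbatim): under Sc″, the pair `(K, c)` it provides at
`(B, γ, δ, Γ₂)` with `δ ≤ B²` obeys `c ≤ 5δK³exp(−2(B²/δ)^{1/5})`. -/
theorem driftStretchSilencingCost_constant_le (h : DriftStretchSilencingCost) {B γ δ Γ₂ : ℝ} (hB : 1 ≤ B)
    (hγ : 0 < γ) (hδ : 0 < δ) (hδB : δ ≤ B ^ 2) (hΓ₂ : 1 ≤ Γ₂) :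
    ∃ K c : ℝ, Γ₂ ≤ K ∧ 0 < c ∧ c ≤ δ ∧ c ≤ 5 * δ * K ^ 3 * Real.exp (-(2 * (B ^ 2 / δ) ^ (1 / 5 : ℝ))) := by
  obtain ⟨K, c, hK, hc, hcδ, H⟩ := h B γ δ Γ₂ hB hγ hδ hΓ₂
  exact ⟨K, c, hK, hc, hcδ, driftStretch_silencingConstant_le hB hδ hδB hΓ₂ hK H⟩

end

end Summit.NavierStokesRegularity.NavierStokesRegularity.Theorems.TypeIQuantSubcubicExp.Negative.SmoothSilence
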